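import Summits.ABC.IUTFork.DAGC312g
import Summits.ABC.IUTFork.Thm311RealThetaPilotFree
import HarnessLib

/-!
# Kernel DAG index — layer C312, part zg (Δ19): the four claim-form THEOREM 3.11 nodes are KERNEL-INHABITED at real data

index Δ19 · abc-iut-c312-2 gen 5 (filer) per HOME/plan/KERNEL-DAG-SPEC.md v1.3 §2(b),(e) clause 2 («a claim-form node is discharged AT A
READING / INSTANTIATION BY NAME when a kernel theorem proves the claim there»), §4 (3). APPEND-ONLY (nothing landed is redefined).
PROOF-ONLY file (no `def`, no new `Prop`, no instance).

THIS FILE PROVES NOTHING NEW AND ASSERTS NOTHING ABOUT PRINT. The index nodes `N_IUTchIII_Thm3_11_i/_ii/_iii` and `N_IUTchIII_Thm3_11`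
(DAGC312g: `Situation.PartI`, `LatticeSituation.PartII`, `FullSituation.PartIII`, `FullSituation.Statement` — [IUTchIII] Thm. 3.11 AS TYPED
by abc-iut-c312-1, claim-form, «NO witness») are here given the witnesses the tree already holds, BY NAME:
* `N_IUTchIII_Thm3_11_inhabited` — there EXIST a number field (`ℚ`), a pilot datum and a full situation of Theorem 3.11 over its REAL
  carriers (probability-weighted verbatim container, analytic logarithms, LGP splitting monoids, (iii)-objects glued from the L6 witness glue)
  at which the typed Theorem 3.11 HOLDS — abc-iut-w5-d236's CLOSED certificate `Thm311.Real.exists_real_fullSituation_statement` over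
  abc-iut-c312-1's `Thm311.Real.full_statement_Pr_LGP` (p418191: the typed Theorem 3.11 holds OUTRIGHT at the probability-weighted real
  instantiation, for every choice of its explicit binders);
* `N_IUTchIII_Thm3_11_parts_inhabited` — hence the three part-nodes (i), (ii), (iii) are inhabited at the same real situation
  (`FullSituation.Statement := PartI ∧ PartII ∧ PartIII`, definitional);
* `N_IUTchIII_Thm3_11_inhabited_at` — the UNIVERSAL form: for EVERY pilot datum `X` over any number field and every choice of the free
  binders of `full_statement_Pr_LGP` there is a full situation over `thetaIndex X` whose typed Theorem 3.11 holds.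

HONEST GLOSS (VERDICT v3.0 §A NB2, abc-iut-w5-d216's N-container, abc-iut-w5-d236): at this real instantiation the typed premise is
CONTENT-FREE — it does not constrain the Θ-pilot (`Thm311.Real.fullSituation_statement_thetaPilot_indep`, re-cited below as
`N_IUTchIII_Thm3_11_inhabited_thetaPilot_free`); «inhabited as typed at a real container» measures the bi-coric strictified typing
(LANA Rem. 8.2.1; Scholze–Stix 2018 §2.2), it is NOT a verdict on the printed Theorem 3.11 and says nothing about [IUTchIII] Cor. 3.12,
whose typed `Cor312.Setting.Statement` this file does not touch. Whether plan/dag book the DAG rows IUTchIII:Thm3.11, (i), (ii), (iii) as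
«discharged at the real reading» under §2(e) clause 2 is THEIR call; the index records the kernel fact either way.
Co-import: F1-NEUTRAL; side B of F-w5d064-1 (via `Thm311RealDegreeFull`, like every consumer of p418191).
Nothing here asserts that abc is proved or refuted or takes a side on [IUTchIII] Cor. 3.12 or on any author. typed ≠ discharged;
indexed ≠ endorsed; inhabited-as-typed ≠ true-in-print. [claim: Mochizuki2012, status: disputed]
[cite: Mochizuki2012, IUTchIII Thm. 3.11 pp. 153–158 (kurims ms paper:url-4b091feeb646)]
-/

noncomputable section

namespace Summit.ABC.IUTFork.DAG

open CategoryTheory Thm311 Thm311.Real Literature.IUT.LogVolume Literature.IUT.LogThetaLattice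
open scoped NumberField

/-- **Δ19-a.** The claim-form node `N_IUTchIII_Thm3_11` ([IUTchIII] Thm. 3.11 (i) ∧ (ii) ∧ (iii) AS TYPED) is KERNEL-INHABITED at REAL data:
some pilot datum over `ℚ` and some full situation over its real carriers satisfy it — abc-iut-w5-d236's closed certificate
`Thm311.Real.exists_real_fullSituation_statement` (over abc-iut-c312-1's `full_statement_Pr_LGP`, p418191), BY NAME. Content-free container
(NB2); inhabited-as-typed ≠ true-in-print; no side taken. [claim: Mochizuki2012, status: disputed] -/
theorem N_IUTchIII_Thm3_11_inhabited :
    ∃ (X : PilotData ℚ) (S : FullSituation (thetaIndex X)), N_IUTchIII_Thm3_11 S :=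
  exists_real_fullSituation_statement

/-- **Δ19-b.** Hence the three part-nodes `N_IUTchIII_Thm3_11_i` (`PartI`), `N_IUTchIII_Thm3_11_ii` (`PartII`), `N_IUTchIII_Thm3_11_iii`
(`PartIII`) are inhabited at the same real full situation (`FullSituation.Statement := PartI ∧ PartII ∧ PartIII`). BY NAME; proves nothing
new; no side taken. [claim: Mochizuki2012, status: disputed] -/
theorem N_IUTchIII_Thm3_11_parts_inhabited :
    ∃ (X : PilotData ℚ) (S : FullSituation (thetaIndex X)),
      N_IUTchIII_Thm3_11_i S.toSituation ∧ N_IUTchIII_Thm3_11_ii S.toLatticeSituation ∧ N_IUTchIII_Thm3_11_iii S := by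
  obtain ⟨X, S, h⟩ := N_IUTchIII_Thm3_11_inhabited
  exact ⟨X, S, h.1, h.2.1, h.2.2⟩

/-- **Δ19-c (universal form).** For EVERY pilot datum `X` over any number field `F` and every choice of the free binders of
`Thm311.Real.full_statement_Pr_LGP` (archimedean sub-structures, action, global moduli, regions, Θ-pilot lgp-divisors, L6 glue / lattice /
`∞κ`-functor, `2l`-th roots and torsion profiles at the bad places) there is a full situation over `thetaIndex X` at which the typed
Theorem 3.11 — the node `N_IUTchIII_Thm3_11` — HOLDS (the situation is the one displayed in p418191; packaged existentially here so that
the index never re-types it). Content-free container (NB2); no side taken. [claim: Mochizuki2012, status: disputed] -/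
theorem N_IUTchIII_Thm3_11_inhabited_at {F : Type} [Field F] [NumberField F] (X : PilotData F)
    (archSub₀ : ∀ (j : (thetaIndex X).Label) (v : (thetaIndex X).V),
      Set ((logShellsDH X (analyticLogv F)).Packet j ((thetaIndex X).over v)))
    (act₀ : ∀ v : (thetaIndex X).V, v ∈ (thetaIndex X).Vbad →
      (logShellsDH X (analyticLogv F)).StarPacket v → Module.End ℚ ((logShellsDH X (analyticLogv F)).StarPacket v))
    (Mmod₀ : ∀ j : (thetaIndex X).LabelStar, Set ((logShellsDH X (analyticLogv F)).GlobalPacket j.1))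
    (region₀ : ℤ → ∀ j : (thetaIndex X).LabelStar, FinDivisor F → ∀ vQ : (thetaIndex X).VQ,
      Set ((logShellsDH X (analyticLogv F)).Packet j.1 vQ))
    (thetaDiv₀ : ℤ → ℤ → LgpDivisor F (thetaIndex X).lstar)
    {S : StripFrame.{0}} (G : LatticeGlue S) (Λ : LogThetaLatticeDiagram G.logData G.linkData)
    {Kap : Type} [Category.{0} Kap] (FM : Core S.DHT ⥤ Kap)
    (qroot : ∀ v : IsDedekindDomain.HeightOneSpectrum (𝓞 F), Thm311.Real.Carrier (.inr v : Thm311.Real.Place F))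
    (ζ : ∀ v : IsDedekindDomain.HeightOneSpectrum (𝓞 F), (thetaIndex X).LabelStar → (Thm311.Real.Carrier (.inr v : Thm311.Real.Place F))ˣ) :
    ∃ Sit : FullSituation (thetaIndex X), N_IUTchIII_Thm3_11 Sit :=
  ⟨_, full_statement_Pr_LGP X archSub₀ act₀ Mmod₀ region₀ thetaDiv₀ G Λ FM qroot ζ⟩

/-- **Δ19-d (the honest gloss, by name).** At that real instantiation the typed Theorem 3.11 places NO constraint on the Θ-pilot: for any
two assignments of Θ-pilot lgp-divisors there are full situations over the same real carriers, with those Θ-pilots, BOTH satisfying the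
node — abc-iut-w5-d236's `Thm311.Real.fullSituation_statement_thetaPilot_indep` re-cited (VERDICT v3.0 §A NB2: content-free container).
This is why «inhabited as typed» here is bookkeeping about the typing, not evidence about print. [claim: Mochizuki2012, status: disputed] -/
theorem N_IUTchIII_Thm3_11_inhabited_thetaPilot_free
    (t t' : ℤ → ℤ → LgpDivisor ℚ (thetaIndex (PilotData.deepAt ℚ 2 5 Nat.prime_five le_rfl 1 one_pos)).lstar) :
    (∃ Sit : FullSituation (thetaIndex (PilotData.deepAt ℚ 2 5 Nat.prime_five le_rfl 1 one_pos)),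
      N_IUTchIII_Thm3_11 Sit ∧ ∀ n m : ℤ, HEq ((Sit.col n).kumLGP m ((Sit.col n).thetaPilot m)) (t n m)) ∧
    ∃ Sit : FullSituation (thetaIndex (PilotData.deepAt ℚ 2 5 Nat.prime_five le_rfl 1 one_pos)),
      N_IUTchIII_Thm3_11 Sit ∧ ∀ n m : ℤ, HEq ((Sit.col n).kumLGP m ((Sit.col n).thetaPilot m)) (t' n m) :=
  fullSituation_statement_thetaPilot_indep t t'

end Summit.ABC.IUTFork.DAG

end
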